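/-
Origin: written from primary sources — R. Howe, *θ-series and invariant theory* (1979) §2–§3 (restriction of the oscillator
representation of the big pair to the see-saw partner is the tensor of the renormalised small ones); S. Kudla, *Seesaw dual
reductive pairs* (1984) §1; W. Fulton, J. Harris, *Representation Theory* (1991) Lecture 6 (`∧²` of a two-dimensional
representation is its determinant). Adapted: no. This file states the OPERATOR-level see-saw restriction at the splitting data
of record in the big pair's own Schrödinger model (from `restrictTmul₁₂/₃₄` of `UnitaryDualPairSeesawSchemeSmall` and the
read-backs `omega_seesawBig(Conj)_apply`) and feeds it to the tree's `wedgePair_mem_weightSpace'`. Kernel only; no records.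
-/
import Literature.NumberTheory.GelbartRogawski1991.UnitaryDualPairSeesawThetaProduct
import Literature.RepresentationTheory.WedgePairDeterminant
import HarnessLib

-- buildfix G11b-3 recipe (LEDGER B13-1/B13-3): elaborate sequentially so the trailing `attribute [implicit_reducible]`
-- block (reducibilityCoreExt is keyed to the async environment branch) is in force at `.olean` export.
set_option Elab.async false

/-!
# The see-saw restriction at OPERATOR level in the big pair's model, and the `K`-type of the wedge test function

Continuation of `UnitaryDualPairSeesawThetaProduct` (which works at the level of the theta functional `Θ`).  For the three
compatible splittings `s, s₁, s₂` of record and the renormalised small representations `ω₁′ = seesawRep₁`, `ω₂′ = seesawRep₂`: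

* §1 **`pairRep_blockDiag_seesawTensor`** — for ALL `g, u₁, u₂, Φ₁, Φ₂`, in the big pair's own model `𝒮(𝔸_F^n)`:
  `ω_ψ(s_pair(g, u₁ ⊕ᶠ u₂)) (Φ₁ ⊗ Φ₂) = (ω₁′(g,u₁) Φ₁) ⊗ (ω₂′(g,u₂) Φ₂)` with `⊗ = seesawTensor` — the restriction of the
  big oscillator representation to `U(J_V) × (U(J₁) × U(J₂))` IS the (transported) external tensor of the renormalised small
  ones [Howe1979, §3; Kudla1984, §1] (the operator form of PerL v5's «`ω_W|_{T(𝔸)×G_U(𝔸)} ≅ ω_{W₁} ⊗ ω_{W₂}`», tex ll. 319–321,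
  with the renormalisation it leaves implicit made explicit); hence the wedge transforms as a `2 × 2` DETERMINANT
  (`pairRep_blockDiag_seesawWedge_eq_det_smul`) and **`seesawWedge_mem_weightSpace`**: if along a family
  `k ↦ (g_k, u₁(k), u₂(k))` both pairs of small test vectors transform through the SAME matrices `m k` under `ω₁′`, `ω₂′`,
  then `φ₁₁ ⊗ φ₂₂ − φ₁₂ ⊗ φ₂₁` is a weight vector of the big representation for `k ↦ det (m k)` (model case: the two pairs are
  matched bases of the `K_∞`-type `𝔭₊` of the two theta one-forms, and the wedge lies in the `κ = ∧²𝔭₊`-isotypic subspace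
  `𝒮^κ` — PerL v5 l. 341 / the `Φ ∈ T.SK` clause of `Gen12FunBridge.wf_gen`);
* §2 the conjugated `(34)` torus: **`pairRep_isometryConj_seesawConjTensor`** (operator-level restriction along
  `(u₁,u₂) ↦ g (u₁ ⊕ᶠ u₂) g⁻¹` for the conjugated pure tensor `R_{e_W} ω(r_F h₀) R_f⁻¹ (Φ₁ ⊠ Φ₂)`), the determinant law and
  `seesawConjWedge_mem_weightSpace`.

Provenance / use (Hodge-CM model-construction cell, rows `gen12`/`real34`): PKG consumer `Gen12FunBridge.wf_gen` of
`HodgeCM/Model/Binders/MeetBridges.lean`, clause `Φ ∈ T.SK V c` (the wedge test function lies in `𝒮^κ`, binder-1-g3's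
`kappaIsotypic` of `UnitaryGroupArchIsotropy`, via the tree's `WedgePairDeterminant`).  Nothing here is a claim of the
manuscripts under adjudication.
-/

set_option autoImplicit false

noncomputable section

open scoped Matrix Kronecker
open NumberField
open Literature.RepresentationTheory Literature.RepresentationTheory.SeesawScalar
open Literature.RepresentationTheory.HeisenbergGroup
open Literature.NumberTheory.Automorphic
open Literature.NumberTheory.Automorphic.UnitaryGroup
open Literature.NumberTheory.Weil1964

namespace Literature.NumberTheory.GelbartRogawski1991

namespace UnitaryDualPair

/-! ## §1 The `(12)` torus: operator-level restriction and the `K`-type of the wedge -/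

section Twelve

variable (F E : Type) [Field F] [NumberField F] [Field E] [NumberField E] [Algebra F E]
variable (c : E ≃ₐ[F] E) (N M₁ M₂ : ℕ) {n n₁ n₂ : ℕ}
  (eW : Fin N × Fin (M₁ + M₂) ≃ Fin n) (e₁ : Fin N × Fin M₁ ≃ Fin n₁) (e₂ : Fin N × Fin M₂ ≃ Fin n₂)
variable (JV : Matrix (Fin N) (Fin N) E) (J₁ : Matrix (Fin M₁) (Fin M₁) E) (J₂ : Matrix (Fin M₂) (Fin M₂) E)
variable {TV : Matrix (Fin N) (Fin N) F} {T₁ : Matrix (Fin M₁) (Fin M₁) F} {T₂ : Matrix (Fin M₂) (Fin M₂) F}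
variable [Algebra.IsQuadraticExtension F E] {δ : E} (hcδ : c δ = -δ) (hδ : δ ≠ 0) {d : F}
  (hd : δ * δ = algebraMap F E d) (hV : TV.IsSymm) (h₁ : T₁.IsSymm) (h₂ : T₂.IsSymm) (hVd : IsUnit TV.det)
  (h₁d : IsUnit T₁.det) (h₂d : IsUnit T₂.det) (hWd : IsUnit (finSum M₁ M₂ T₁ T₂).det)
  (hJV : JV = TV.map (algebraMap F E)) (hJ₁ : J₁ = T₁.map (algebraMap F E)) (hJ₂ : J₂ = T₂.map (algebraMap F E))
  {s : adelicPair F E c N (M₁ + M₂) JV (finSum M₁ M₂ J₁ J₂) →*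
    adelicMpCont F (Fin n) (adelicGram F eW TV (finSum M₁ M₂ T₁ T₂))}
  {s₁ : adelicPair F E c N M₁ JV J₁ →* adelicMpCont F (Fin n₁) (adelicGram F e₁ TV T₁)}
  {s₂ : adelicPair F E c N M₂ JV J₂ →* adelicMpCont F (Fin n₂) (adelicGram F e₂ TV T₂)}
  (hs : (splittingDatum F E c N (M₁ + M₂) eW JV (finSum M₁ M₂ J₁ J₂) hcδ hδ hd hV (isSymm_finSum h₁ h₂) hVd hWd hJV
    (finSum_eq_map_finSum F E M₁ M₂ J₁ J₂ hJ₁ hJ₂)).IsCompatible s)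
  (hs₁ : (splittingDatum F E c N M₁ e₁ JV J₁ hcδ hδ hd hV h₁ hVd h₁d hJV hJ₁).IsCompatible s₁)
  (hs₂ : (splittingDatum F E c N M₂ e₂ JV J₂ hcδ hδ hd hV h₂ hVd h₂d hJV hJ₂).IsCompatible s₂)

/-- **THE SEE-SAW RESTRICTION AT OPERATOR LEVEL, data of record, `(12)` torus**: in the big pair's own model,
`ω_ψ(s_pair(g, u₁ ⊕ᶠ u₂)) (Φ₁ ⊗ Φ₂) = (ω₁′(g,u₁) Φ₁) ⊗ (ω₂′(g,u₂) Φ₂)`. [cite: Howe1979, §3] -/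
theorem pairRep_blockDiag_seesawTensor (g : adelic F E c N JV) (u₁ : adelic F E c M₁ J₁) (u₂ : adelic F E c M₂ J₂)
    (Φ₁ : piSchwartzBruhat F (Fin N × Fin M₁)) (Φ₂ : piSchwartzBruhat F (Fin N × Fin M₂)) :
    pairRep F E c N (M₁ + M₂) eW JV (finSum M₁ M₂ J₁ J₂) s (g, adelicBlockDiag F E c M₁ M₂ J₁ J₂ (u₁, u₂))
        (seesawTensor F N M₁ M₂ eW Φ₁ Φ₂) =
      seesawTensor F N M₁ M₂ eW (seesawRep₁ F E c N M₁ M₂ eW e₁ e₂ JV J₁ J₂ hcδ hδ hd hV h₁ h₂ hVd h₁d h₂d hWd hJV hJ₁ hJ₂ hs hs₁ hs₂ (g, u₁) Φ₁) (seesawRep₂ F E c N M₁ M₂ eW e₁ e₂ JV J₁ J₂ hcδ hδ hd hV h₁ h₂ hVd h₁d h₂d hWd hJV hJ₁ hJ₂ hs hs₁ hs₂ (g, u₂) Φ₂) :=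
  ((piSBReindex F eW).apply_symm_apply _).symm.trans
    (congrArg (piSBReindex F eW)
      ((omega_seesawBig_apply F E c N M₁ M₂ eW JV J₁ J₂ s (g, (u₁, u₂))
          ((piSBReindex F (finProdSumEquiv N M₁ M₂)).symm
            (tensorToSum F (Fin N × Fin M₁) (Fin N × Fin M₂) Φ₁ Φ₂))).symm.trans
        (((piSBReindex F (finProdSumEquiv N M₁ M₂)).symm_apply_apply _).symm.trans
          (congrArg (piSBReindex F (finProdSumEquiv N M₁ M₂)).symm
            ((omega_seesawBigSum_apply F E c N M₁ M₂ eW JV J₁ J₂ (s := s) (g, (u₁, u₂))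
                (tensorToSum F (Fin N × Fin M₁) (Fin N × Fin M₂) Φ₁ Φ₂)).symm.trans
              (restrictTmul₁₂ F E c N M₁ M₂ eW e₁ e₂ JV J₁ J₂ hcδ hδ hd hV h₁ h₂ hVd h₁d h₂d hWd hJV hJ₁ hJ₂ hs hs₁ hs₂ g u₁ u₂ Φ₁ Φ₂))))))

/-- the wedge test function is the tree's `wedgePair` of the two pairs through `seesawTensor`. [folklore] -/
theorem seesawWedge_eq_wedgePair (φ₁ : Fin 2 → piSchwartzBruhat F (Fin N × Fin M₁))
    (φ₂ : Fin 2 → piSchwartzBruhat F (Fin N × Fin M₂)) :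
    seesawWedge F N M₁ M₂ eW (φ₁ 0) (φ₁ 1) (φ₂ 0) (φ₂ 1) = wedgePair (seesawTensor F N M₁ M₂ eW) φ₁ φ₂ :=
  rfl

/-- **The wedge transforms by the determinant**: if `ω₁′(g,u₁)` acts on the pair `φ₁` and `ω₂′(g,u₂)` on the pair `φ₂`
through the SAME matrix `m` (`ω_j′ (φ_j i) = Σ_l m l i • φ_j l`), then
`ω_ψ(s_pair(g, u₁ ⊕ᶠ u₂)) (φ₁₀ ⊗ φ₂₁ − φ₁₁ ⊗ φ₂₀) = det m • (φ₁₀ ⊗ φ₂₁ − φ₁₁ ⊗ φ₂₀)`. [cite: Howe1979, §3] -/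
theorem pairRep_blockDiag_seesawWedge_eq_det_smul (g : adelic F E c N JV) (u₁ : adelic F E c M₁ J₁)
    (u₂ : adelic F E c M₂ J₂) (φ₁ : Fin 2 → piSchwartzBruhat F (Fin N × Fin M₁))
    (φ₂ : Fin 2 → piSchwartzBruhat F (Fin N × Fin M₂)) (m : Matrix (Fin 2) (Fin 2) ℂ)
    (hA : ∀ i, seesawRep₁ F E c N M₁ M₂ eW e₁ e₂ JV J₁ J₂ hcδ hδ hd hV h₁ h₂ hVd h₁d h₂d hWd hJV hJ₁ hJ₂ hs hs₁ hs₂ (g, u₁) (φ₁ i) = ∑ l, m l i • φ₁ l)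
    (hB : ∀ i, seesawRep₂ F E c N M₁ M₂ eW e₁ e₂ JV J₁ J₂ hcδ hδ hd hV h₁ h₂ hVd h₁d h₂d hWd hJV hJ₁ hJ₂ hs hs₁ hs₂ (g, u₂) (φ₂ i) = ∑ l, m l i • φ₂ l) :
    pairRep F E c N (M₁ + M₂) eW JV (finSum M₁ M₂ J₁ J₂) s (g, adelicBlockDiag F E c M₁ M₂ J₁ J₂ (u₁, u₂))
        (wedgePair (seesawTensor F N M₁ M₂ eW) φ₁ φ₂) =
      m.det • wedgePair (seesawTensor F N M₁ M₂ eW) φ₁ φ₂ := by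
  exact ((map_sub (pairRep F E c N (M₁ + M₂) eW JV (finSum M₁ M₂ J₁ J₂) s
      (g, adelicBlockDiag F E c M₁ M₂ J₁ J₂ (u₁, u₂))) (seesawTensor F N M₁ M₂ eW (φ₁ 0) (φ₂ 1))
      (seesawTensor F N M₁ M₂ eW (φ₁ 1) (φ₂ 0))).trans
    (congrArg₂ (· - ·) (pairRep_blockDiag_seesawTensor F E c N M₁ M₂ eW e₁ e₂ JV J₁ J₂ hcδ hδ hd hV h₁ h₂ hVd h₁d h₂d hWd hJV hJ₁ hJ₂ hs hs₁ hs₂ g u₁ u₂ (φ₁ 0) (φ₂ 1))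
      (pairRep_blockDiag_seesawTensor F E c N M₁ M₂ eW e₁ e₂ JV J₁ J₂ hcδ hδ hd hV h₁ h₂ hVd h₁d h₂d hWd hJV hJ₁ hJ₂ hs hs₁ hs₂ g u₁ u₂ (φ₁ 1) (φ₂ 0)))).trans
    (wedgePair_of_matrix (seesawTensor F N M₁ M₂ eW) φ₁ φ₂ m _ _ hA hB)

/-- **The wedge test function is a weight vector for `det`**: along any family `k ↦ (g_k, u₁(k), u₂(k))` under which
both pairs transform through the same matrices `m k`, `φ₁₀ ⊗ φ₂₁ − φ₁₁ ⊗ φ₂₀ ∈ weightSpace (ω_ψ ∘ s_pair) ι (det ∘ m)`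
(model case: `K_∞`-type `κ = ∧²𝔭₊`, the `𝒮^κ` clause of PerL v5 l. 341). [cite: Howe1979, §3] -/
theorem seesawWedge_mem_weightSpace {ι : Type*} (gV : ι → adelic F E c N JV) (k₁ : ι → adelic F E c M₁ J₁)
    (k₂ : ι → adelic F E c M₂ J₂) (φ₁ : Fin 2 → piSchwartzBruhat F (Fin N × Fin M₁))
    (φ₂ : Fin 2 → piSchwartzBruhat F (Fin N × Fin M₂)) (m : ι → Matrix (Fin 2) (Fin 2) ℂ)
    (hA : ∀ (k : ι) (i : Fin 2), seesawRep₁ F E c N M₁ M₂ eW e₁ e₂ JV J₁ J₂ hcδ hδ hd hV h₁ h₂ hVd h₁d h₂d hWd hJV hJ₁ hJ₂ hs hs₁ hs₂ (gV k, k₁ k) (φ₁ i) = ∑ l, m k l i • φ₁ l)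
    (hB : ∀ (k : ι) (i : Fin 2), seesawRep₂ F E c N M₁ M₂ eW e₁ e₂ JV J₁ J₂ hcδ hδ hd hV h₁ h₂ hVd h₁d h₂d hWd hJV hJ₁ hJ₂ hs hs₁ hs₂ (gV k, k₂ k) (φ₂ i) = ∑ l, m k l i • φ₂ l) :
    wedgePair (seesawTensor F N M₁ M₂ eW) φ₁ φ₂ ∈
      weightSpace (pairRep F E c N (M₁ + M₂) eW JV (finSum M₁ M₂ J₁ J₂) s)
        (fun k => (gV k, adelicBlockDiag F E c M₁ M₂ J₁ J₂ (k₁ k, k₂ k))) (fun k => (m k).det) :=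
  mem_weightSpace.mpr fun k =>
    pairRep_blockDiag_seesawWedge_eq_det_smul F E c N M₁ M₂ eW e₁ e₂ JV J₁ J₂ hcδ hδ hd hV h₁ h₂ hVd h₁d h₂d hWd hJV hJ₁ hJ₂ hs hs₁ hs₂ (gV k) (k₁ k) (k₂ k) φ₁ φ₂ (m k) (hA k) (hB k)

end Twelve

/-! ## §2 The conjugated `(34)` torus: operator-level restriction and the `K`-type of the wedge -/

section ThirtyFour


variable (F E : Type) [Field F] [NumberField F] [Field E] [NumberField E] [Algebra F E]
variable (c : E ≃ₐ[F] E) (N M₁ M₂ : ℕ) {n n₁ n₂ : ℕ} (eW : Fin N × Fin (M₁ + M₂) ≃ Fin n)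
  (e₁ : Fin N × Fin M₁ ≃ Fin n₁) (e₂ : Fin N × Fin M₂ ≃ Fin n₂)
variable (JV : Matrix (Fin N) (Fin N) E) (JW : Matrix (Fin (M₁ + M₂)) (Fin (M₁ + M₂)) E)
  (J₁ : Matrix (Fin M₁) (Fin M₁) E) (J₂ : Matrix (Fin M₂) (Fin M₂) E)
variable {TV : Matrix (Fin N) (Fin N) F} {TW : Matrix (Fin (M₁ + M₂)) (Fin (M₁ + M₂)) F}
  {T₁ : Matrix (Fin M₁) (Fin M₁) F} {T₂ : Matrix (Fin M₂) (Fin M₂) F}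
variable [Algebra.IsQuadraticExtension F E] {δ : E} (hcδ : c δ = -δ) (hδ : δ ≠ 0) {d : F}
  (hd : δ * δ = algebraMap F E d) (hV : TV.IsSymm) (hW : TW.IsSymm) (h₁ : T₁.IsSymm) (h₂ : T₂.IsSymm)
  (hVd : IsUnit TV.det) (hTWd : IsUnit TW.det) (h₁d : IsUnit T₁.det) (h₂d : IsUnit T₂.det)
  (hT : IsUnit (TV.map (algebraMap F (AdeleRing (𝓞 F) F)) ⊗ₖ TW.map (algebraMap F (AdeleRing (𝓞 F) F))).det)
  (hJV : JV = TV.map (algebraMap F E)) (hJW : JW = TW.map (algebraMap F E))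
  (hJ₁ : J₁ = T₁.map (algebraMap F E)) (hJ₂ : J₂ = T₂.map (algebraMap F E))
  {s : adelicPair F E c N (M₁ + M₂) JV JW →* adelicMpCont F (Fin n) (adelicGram F eW TV TW)}
  {s₁ : adelicPair F E c N M₁ JV J₁ →* adelicMpCont F (Fin n₁) (adelicGram F e₁ TV T₁)}
  {s₂ : adelicPair F E c N M₂ JV J₂ →* adelicMpCont F (Fin n₂) (adelicGram F e₂ TV T₂)}
  {g : GL (Fin (M₁ + M₂)) (AdeleRing (𝓞 E) E)} {g₀ : GL (Fin (M₁ + M₂)) E}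
  (hgg₀ : (g : Matrix (Fin (M₁ + M₂)) (Fin (M₁ + M₂)) (AdeleRing (𝓞 E) E)) =
    ((g₀ : GL (Fin (M₁ + M₂)) E) : Matrix (Fin (M₁ + M₂)) (Fin (M₁ + M₂)) E).map (algebraMap E (AdeleRing (𝓞 E) E)))
  (hg : ((g : Matrix (Fin (M₁ + M₂)) (Fin (M₁ + M₂)) (AdeleRing (𝓞 E) E)).map (conjAdele F E c))ᵀ *
      adelicForm E (M₁ + M₂) JW * g = adelicForm E (M₁ + M₂) (finSum M₁ M₂ J₁ J₂))
  {C : GL (Fin N × Fin (M₁ + M₂)) (AdeleRing (𝓞 F) F)} {C₀ : GL (Fin N × Fin (M₁ + M₂)) F}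
  (hCC₀ : (C : Matrix (Fin N × Fin (M₁ + M₂)) (Fin N × Fin (M₁ + M₂)) (AdeleRing (𝓞 F) F)) =
    ((C₀ : GL (Fin N × Fin (M₁ + M₂)) F) : Matrix (Fin N × Fin (M₁ + M₂)) (Fin N × Fin (M₁ + M₂)) F).map
      (algebraMap F (AdeleRing (𝓞 F) F)))
  (hC : TV.map (algebraMap F (AdeleRing (𝓞 F) F)) ⊗ₖ TW.map (algebraMap F (AdeleRing (𝓞 F) F)) *
      (C : Matrix (Fin N × Fin (M₁ + M₂)) (Fin N × Fin (M₁ + M₂)) (AdeleRing (𝓞 F) F)) =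
    TV.map (algebraMap F (AdeleRing (𝓞 F) F)) ⊗ₖ (finSum M₁ M₂ T₁ T₂).map (algebraMap F (AdeleRing (𝓞 F) F)))
  (hs : (splittingDatum F E c N (M₁ + M₂) eW JV JW hcδ hδ hd hV hW hVd hTWd hJV hJW).IsCompatible s)
  (hs₁ : (splittingDatum F E c N M₁ e₁ JV J₁ hcδ hδ hd hV h₁ hVd h₁d hJV hJ₁).IsCompatible s₁)
  (hs₂ : (splittingDatum F E c N M₂ e₂ JV J₂ hcδ hδ hd hV h₂ hVd h₂d hJV hJ₂).IsCompatible s₂)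
/-- **THE SEE-SAW RESTRICTION AT OPERATOR LEVEL, data of record, conjugated `(34)` torus**: in the big pair
`(U(J_V), U(J_W))`'s own model, `ω_ψ(s_pair(v, g (u₁ ⊕ᶠ u₂) g⁻¹)) (Φ₁ ⊗' Φ₂) = (ω₁″(v,u₁) Φ₁) ⊗' (ω₂″(v,u₂) Φ₂)` with
`⊗' = seesawConjTensor` (the pure tensor read through `R_{e_W} ω(r_F h₀) R_f⁻¹`). [cite: Howe1979, §3] -/
theorem pairRep_isometryConj_seesawConjTensor (v : adelic F E c N JV) (u₁ : adelic F E c M₁ J₁) (u₂ : adelic F E c M₂ J₂)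
    (Φ₁ : piSchwartzBruhat F (Fin N × Fin M₁)) (Φ₂ : piSchwartzBruhat F (Fin N × Fin M₂)) :
    pairRep F E c N (M₁ + M₂) eW JV JW s
        (v, adelicIsometryConj F E c (M₁ + M₂) g hg (adelicBlockDiag F E c M₁ M₂ J₁ J₂ (u₁, u₂)))
        (seesawConjTensor F E c N M₁ M₂ eW JV JW J₁ J₂ hcδ hδ hd hV hW h₁ h₂ hVd hTWd hT hJV hJW hJ₁ hJ₂ hgg₀ hg hCC₀ hC Φ₁ Φ₂) =
      seesawConjTensor F E c N M₁ M₂ eW JV JW J₁ J₂ hcδ hδ hd hV hW h₁ h₂ hVd hTWd hT hJV hJW hJ₁ hJ₂ hgg₀ hg hCC₀ hC (seesawConjRep₁ F E c N M₁ M₂ eW e₁ e₂ JV JW J₁ J₂ hcδ hδ hd hV hW h₁ h₂ hVd hTWd h₁d h₂d hT hJV hJW hJ₁ hJ₂ hgg₀ hg hCC₀ hC hs hs₁ hs₂ (v, u₁) Φ₁) (seesawConjRep₂ F E c N M₁ M₂ eW e₁ e₂ JV JW J₁ J₂ hcδ hδ hd hV hW h₁ h₂ hVd hTWd h₁d h₂d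 hT hJV hJW hJ₁ hJ₂ hgg₀ hg hCC₀ hC hs hs₁ hs₂ (v, u₂) Φ₂) :=
  ((piSBReindex F eW).apply_symm_apply _).symm.trans
    (congrArg (piSBReindex F eW)
      ((omega_seesawBigConj_apply F E c N M₁ M₂ eW JV JW J₁ J₂ s g hg (v, (u₁, u₂))
          (adelicMpCont.omega F (Fin N × Fin (M₁ + M₂))
            (TV.map (algebraMap F (AdeleRing (𝓞 F) F)) ⊗ₖ TW.map (algebraMap F (AdeleRing (𝓞 F) F)))
            (ratPointsThetaLiftCont F (Fin N × Fin (M₁ + M₂)) _ hT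
          ⟨seesawElement F E c N M₁ M₂ JV JW J₁ J₂ hcδ hδ hd hV hW h₁ h₂ hJV hJW hJ₁ hJ₂ hg hC,
            seesawElement_mem_range F E c N M₁ M₂ JV JW J₁ J₂ hcδ hδ hd hV hW h₁ h₂ hVd hTWd hT hJV hJW hJ₁ hJ₂ hgg₀
              hg hCC₀ hC⟩)
            ((piSBReindex F (finProdSumEquiv N M₁ M₂)).symm
              (tensorToSum F (Fin N × Fin M₁) (Fin N × Fin M₂) Φ₁ Φ₂)))).symm.trans
        ((omega_apply_omega_ratConjSplitting F (Fin N × Fin (M₁ + M₂)) hT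
            (seesawElement F E c N M₁ M₂ JV JW J₁ J₂ hcδ hδ hd hV hW h₁ h₂ hJV hJW hJ₁ hJ₂ hg hC)
            (seesawElement_mem_range F E c N M₁ M₂ JV JW J₁ J₂ hcδ hδ hd hV hW h₁ h₂ hVd hTWd hT hJV hJW hJ₁ hJ₂ hgg₀
              hg hCC₀ hC)
            C hC (seesawBigConj F E c N M₁ M₂ eW JV JW J₁ J₂ s g hg) (v, (u₁, u₂)) _).symm.trans
          (congrArg
            (adelicMpCont.omega F (Fin N × Fin (M₁ + M₂))
              (TV.map (algebraMap F (AdeleRing (𝓞 F) F)) ⊗ₖ TW.map (algebraMap F (AdeleRing (𝓞 F) F)))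
              (ratPointsThetaLiftCont F (Fin N × Fin (M₁ + M₂)) _ hT
          ⟨seesawElement F E c N M₁ M₂ JV JW J₁ J₂ hcδ hδ hd hV hW h₁ h₂ hJV hJW hJ₁ hJ₂ hg hC,
            seesawElement_mem_range F E c N M₁ M₂ JV JW J₁ J₂ hcδ hδ hd hV hW h₁ h₂ hVd hTWd hT hJV hJW hJ₁ hJ₂ hgg₀
              hg hCC₀ hC⟩))
            (((piSBReindex F (finProdSumEquiv N M₁ M₂)).symm_apply_apply _).symm.trans
              (congrArg (piSBReindex F (finProdSumEquiv N M₁ M₂)).symm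
                ((omega_sumSeesawSplitting_apply (finProdSumEquiv N M₁ M₂) (reindex_gram_finSum F N M₁ M₂)
                    (seesawConjSplitting F E c N M₁ M₂ eW JV JW J₁ J₂ hcδ hδ hd hV hW h₁ h₂ hVd hTWd hT hJV hJW hJ₁ hJ₂
                      hgg₀ hg hCC₀ hC (s := s)) (v, (u₁, u₂))
                    (tensorToSum F (Fin N × Fin M₁) (Fin N × Fin M₂) Φ₁ Φ₂)).symm.trans
                  (restrictTmul₃₄ F E c N M₁ M₂ eW e₁ e₂ JV JW J₁ J₂ hcδ hδ hd hV hW h₁ h₂ hVd hTWd h₁d h₂d hT hJV hJW hJ₁ hJ₂ hgg₀ hg hCC₀ hC hs hs₁ hs₂ v u₁ u₂ Φ₁ Φ₂))))))))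

/-- the conjugated wedge test function is the tree's `wedgePair` through `seesawConjTensor`. [folklore] -/
theorem seesawConjWedge_eq_wedgePair (φ₁ : Fin 2 → piSchwartzBruhat F (Fin N × Fin M₁))
    (φ₂ : Fin 2 → piSchwartzBruhat F (Fin N × Fin M₂)) :
    seesawConjWedge F E c N M₁ M₂ eW JV JW J₁ J₂ hcδ hδ hd hV hW h₁ h₂ hVd hTWd hT hJV hJW hJ₁ hJ₂ hgg₀ hg hCC₀ hC (φ₁ 0) (φ₁ 1) (φ₂ 0) (φ₂ 1) = wedgePair (seesawConjTensor F E c N M₁ M₂ eW JV JW J₁ J₂ hcδ hδ hd hV hW h₁ h₂ hVd hTWd hT hJV hJW hJ₁ hJ₂ hgg₀ hg hCC₀ hC) φ₁ φ₂ :=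
  rfl

/-- **The conjugated wedge transforms by the determinant** (same matrix `m` for both pairs under `ω₁″(v,u₁)`,
`ω₂″(v,u₂)`). [cite: Howe1979, §3] -/
theorem pairRep_isometryConj_seesawConjWedge_eq_det_smul (v : adelic F E c N JV) (u₁ : adelic F E c M₁ J₁)
    (u₂ : adelic F E c M₂ J₂) (φ₁ : Fin 2 → piSchwartzBruhat F (Fin N × Fin M₁))
    (φ₂ : Fin 2 → piSchwartzBruhat F (Fin N × Fin M₂)) (m : Matrix (Fin 2) (Fin 2) ℂ)
    (hA : ∀ i, seesawConjRep₁ F E c N M₁ M₂ eW e₁ e₂ JV JW J₁ J₂ hcδ hδ hd hV hW h₁ h₂ hVd hTWd h₁d h₂d hT hJV hJW hJ₁ hJ₂ hgg₀ hg hCC₀ hC hs hs₁ hs₂ (v, u₁) (φ₁ i) = ∑ l, m l i • φ₁ l)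
    (hB : ∀ i, seesawConjRep₂ F E c N M₁ M₂ eW e₁ e₂ JV JW J₁ J₂ hcδ hδ hd hV hW h₁ h₂ hVd hTWd h₁d h₂d hT hJV hJW hJ₁ hJ₂ hgg₀ hg hCC₀ hC hs hs₁ hs₂ (v, u₂) (φ₂ i) = ∑ l, m l i • φ₂ l) :
    pairRep F E c N (M₁ + M₂) eW JV JW s
        (v, adelicIsometryConj F E c (M₁ + M₂) g hg (adelicBlockDiag F E c M₁ M₂ J₁ J₂ (u₁, u₂)))
        (wedgePair (seesawConjTensor F E c N M₁ M₂ eW JV JW J₁ J₂ hcδ hδ hd hV hW h₁ h₂ hVd hTWd hT hJV hJW hJ₁ hJ₂ hgg₀ hg hCC₀ hC) φ₁ φ₂) =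
      m.det • wedgePair (seesawConjTensor F E c N M₁ M₂ eW JV JW J₁ J₂ hcδ hδ hd hV hW h₁ h₂ hVd hTWd hT hJV hJW hJ₁ hJ₂ hgg₀ hg hCC₀ hC) φ₁ φ₂ :=
  ((map_sub (pairRep F E c N (M₁ + M₂) eW JV JW s
      (v, adelicIsometryConj F E c (M₁ + M₂) g hg (adelicBlockDiag F E c M₁ M₂ J₁ J₂ (u₁, u₂))))
      (seesawConjTensor F E c N M₁ M₂ eW JV JW J₁ J₂ hcδ hδ hd hV hW h₁ h₂ hVd hTWd hT hJV hJW hJ₁ hJ₂ hgg₀ hg hCC₀ hC (φ₁ 0) (φ₂ 1)) (seesawConjTensor F E c N M₁ M₂ eW JV JW J₁ J₂ hcδ hδ hd hV hW h₁ h₂ hVd hTWd hT hJV hJW hJ₁ hJ₂ hgg₀ hg hCC₀ hC (φ₁ 1) (φ₂ 0))).trans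
    (congrArg₂ (· - ·) (pairRep_isometryConj_seesawConjTensor F E c N M₁ M₂ eW e₁ e₂ JV JW J₁ J₂ hcδ hδ hd hV hW h₁ h₂ hVd hTWd h₁d h₂d hT hJV hJW hJ₁ hJ₂ hgg₀ hg hCC₀ hC hs hs₁ hs₂ v u₁ u₂ (φ₁ 0) (φ₂ 1))
      (pairRep_isometryConj_seesawConjTensor F E c N M₁ M₂ eW e₁ e₂ JV JW J₁ J₂ hcδ hδ hd hV hW h₁ h₂ hVd hTWd h₁d h₂d hT hJV hJW hJ₁ hJ₂ hgg₀ hg hCC₀ hC hs hs₁ hs₂ v u₁ u₂ (φ₁ 1) (φ₂ 0)))).trans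
    (wedgePair_of_matrix (seesawConjTensor F E c N M₁ M₂ eW JV JW J₁ J₂ hcδ hδ hd hV hW h₁ h₂ hVd hTWd hT hJV hJW hJ₁ hJ₂ hgg₀ hg hCC₀ hC) φ₁ φ₂ m _ _ hA hB)

/-- **The conjugated wedge is a weight vector for `det`** along any family `k ↦ (v_k, g (u₁(k) ⊕ᶠ u₂(k)) g⁻¹)` under
which both pairs transform through the same matrices. [cite: Howe1979, §3] -/
theorem seesawConjWedge_mem_weightSpace {ι : Type*} (gV : ι → adelic F E c N JV) (k₁ : ι → adelic F E c M₁ J₁)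
    (k₂ : ι → adelic F E c M₂ J₂) (φ₁ : Fin 2 → piSchwartzBruhat F (Fin N × Fin M₁))
    (φ₂ : Fin 2 → piSchwartzBruhat F (Fin N × Fin M₂)) (m : ι → Matrix (Fin 2) (Fin 2) ℂ)
    (hA : ∀ (k : ι) (i : Fin 2), seesawConjRep₁ F E c N M₁ M₂ eW e₁ e₂ JV JW J₁ J₂ hcδ hδ hd hV hW h₁ h₂ hVd hTWd h₁d h₂d hT hJV hJW hJ₁ hJ₂ hgg₀ hg hCC₀ hC hs hs₁ hs₂ (gV k, k₁ k) (φ₁ i) = ∑ l, m k l i • φ₁ l)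
    (hB : ∀ (k : ι) (i : Fin 2), seesawConjRep₂ F E c N M₁ M₂ eW e₁ e₂ JV JW J₁ J₂ hcδ hδ hd hV hW h₁ h₂ hVd hTWd h₁d h₂d hT hJV hJW hJ₁ hJ₂ hgg₀ hg hCC₀ hC hs hs₁ hs₂ (gV k, k₂ k) (φ₂ i) = ∑ l, m k l i • φ₂ l) :
    wedgePair (seesawConjTensor F E c N M₁ M₂ eW JV JW J₁ J₂ hcδ hδ hd hV hW h₁ h₂ hVd hTWd hT hJV hJW hJ₁ hJ₂ hgg₀ hg hCC₀ hC) φ₁ φ₂ ∈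
      weightSpace (pairRep F E c N (M₁ + M₂) eW JV JW s)
        (fun k => (gV k, adelicIsometryConj F E c (M₁ + M₂) g hg (adelicBlockDiag F E c M₁ M₂ J₁ J₂ (k₁ k, k₂ k))))
        (fun k => (m k).det) :=
  mem_weightSpace.mpr fun k =>
    pairRep_isometryConj_seesawConjWedge_eq_det_smul F E c N M₁ M₂ eW e₁ e₂ JV JW J₁ J₂ hcδ hδ hd hV hW h₁ h₂ hVd hTWd h₁d h₂d hT hJV hJW hJ₁ hJ₂ hgg₀ hg hCC₀ hC hs hs₁ hs₂ (gV k) (k₁ k) (k₂ k) φ₁ φ₂ (m k) (hA k) (hB k)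

end ThirtyFour

/-! ### Build-lane note (ops-buildfix G11b-3 recipe, LEDGER B13-1, 2026-08-21)
`lean -o` (the hub build lane, never `lean`/the gate check) runs Lean 4.32's library-suggestion indexers
(`Lean.LibrarySuggestions.SymbolFrequency` / `SineQuaNon`, from their `exportEntriesFn`) over the statement of
every local theorem that is not a denied premise; on this family's statements (very large dependent binder
telescopes through the theta-kernel / dual-pair data) that fold runs for tens of minutes to hours and the build
lane kills the job (incident G11b-3, run/shared/lean/ops/buildfix/G11b-3-DOSSIER.md). `isDeniedPremise` skips
`[implicit_reducible]` constants before any fold, and a reducibility status on a *theorem* is inert (Meta never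
unfolds `thmInfo`; the kernel ignores the attribute), so the public theorems of this file are tagged
`[implicit_reducible]` purely to keep them out of that index. Only other effect: they are not offered by
`+suggestions` premise selectors. No statement or proof is changed; superseded if the operator lands a
deny-list form (`HarnessLib.PremiseIndex`). -/
set_option allowUnsafeReducibility true in
attribute [implicit_reducible]
  pairRep_blockDiag_seesawTensor seesawWedge_eq_wedgePair pairRep_blockDiag_seesawWedge_eq_det_smul
  seesawWedge_mem_weightSpace pairRep_isometryConj_seesawConjTensor seesawConjWedge_eq_wedgePair
  pairRep_isometryConj_seesawConjWedge_eq_det_smul seesawConjWedge_mem_weightSpace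

end UnitaryDualPair

end Literature.NumberTheory.GelbartRogawski1991

end
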